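import Summits.AtomisticToContinuum.HydrodynamicLimit.Theses.LoschmidtIsentropicSelection
import Literature.Probability.Entropy.EntropyInequality

/-!
# Crux `AutonomousClosure` (stmt-AtomisticToContinuum-13749) — the strategist's typed split (glue for `route edit --split`)

Glue for the DECOMPOSITION of the deciding crux
`Summit.AtomisticToContinuum.HydrodynamicLimit.Theses.LoschmidtIsentropicSelection.AutonomousClosure` (rank 2, route
AtomisticToContinuum/LoschmidtIsentropicSelection; re-audit bin RESTATED: with `p̃ := hsPressure σ` its convergence clause
is a σ-uniform form of the guarded conjunct) into TWO leaf statements along the seam of the relative entropy method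
(Yau 1991; Olla–Varadhan–Yau 1993, §1; Kipnis–Landim 1999, Ch. 6 and App. 1 §8):

* `EntropicClosure` (DYNAMIC, EOS-agnostic, the heart): below a packing threshold there is a smooth, locally well-posed
  pressure law `p̃_σ` such that along every guarded classical Euler[p̃_σ] solution `(ρ, u, θ)` started in local
  equilibrium (local Gibbs data whose fields converge at `t = 0`), at every later time `t < T` SOME local Gibbs law with
  the solution's velocity and temperature slices `(u_t, θ_t)` and an activity `a_t` realising the density slice `ρ_t`
  (law of large numbers at time `0`) has vanishing SPECIFIC relative entropy distance from the true law:
  `H((Φ_t)_* LG(a₀,u₀,θ₀) | LG(a_t,u_t,θ_t)) / (N+1) → 0`.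
* `LocalGibbsExpConcentration` (STATIC): a local Gibbs law at packing `< η₀` whose empirical fields obey the law of
  large numbers towards continuous positive profiles `(ρ̄, u, θ)` concentrates its three empirical fields
  EXPONENTIALLY, `≤ C e^{-(N+1)/C}` (large deviations for dilute hard-sphere Gibbs fields with Maxwellian marks).

THEOREM `autonomousClosure_of_subs : EntropicClosure → LocalGibbsExpConcentration → AutonomousClosure` (children stated
verbatim, in arrow form, as filed with `route edit --split AutonomousClosure`; conclusion the route decl BY NAME).  The
proof is the end-game of the relative entropy method, carried out here once and for all: the entropy inequality for
events `μ(A) ≤ (log 2 + H(μ|ν)) / log(1 + 1/ν(A))` (tree: `Literature.Probability.Entropy.KipnisLandim1999_A1_8_2_holds`,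
proved from Mathlib's `klDiv`) applied to the measurable hull of the deviation events, the asymptotics
`(log 2 + o(N+1)) / ((N+1)/C − log C) → 0`, absolute continuity in the null case, and the push-forward inequality
`LG₀{z | Φ_t z ∈ A} ≤ ((Φ_t)_* LG₀)(A)` (`Measure.le_map_apply`, `HardSphereFlow.measurable_flow`); thresholds
`η₀ := min η₁ η₂`, the smoothness domain and the well-posedness clause pass to the smaller threshold by monotonicity,
and the slices `ρ_t, u_t, θ_t` of a classical solution are continuous and positive (the bound predicate `IsSol`).
HONESTY: `EntropicClosure` is Yau's (stronger, entropic) form of the closure and does not give `AutonomousClosure` or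
the Statement without its static sibling; `LocalGibbsExpConcentration` is dynamics-free.  No new definitions.
-/

namespace Summit.AtomisticToContinuum.HydrodynamicLimit.Theorems

open MeasureTheory Filter Set Topology
open scoped ENNReal

/-- **Entropy inequality, thresholded form.** For probability measures `μ`, `ν` with finite relative
entropy `H(μ | ν) = klDiv μ ν` and any set `A` (measurable or not) with `ν A ≤ q`, `0 < q`:
`μ A ≤ (log 2 + H(μ | ν)) / log (1 + q⁻¹)` — Kipnis–Landim 1999, App. 1, Prop. 8.2 applied to the
measurable hull of `A`, with the monotonicity of `r ↦ log (1 + r⁻¹)`; the case `ν A = 0` is absolute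
continuity. [cite: KipnisLandim1999, Appendix 1 Prop. 8.2] -/
theorem measureReal_le_entropy_bound {E : Type} [MeasurableSpace E] (μ ν : Measure E)
    [IsProbabilityMeasure μ] [IsProbabilityMeasure ν] (A : Set E) {q : ℝ} (hq : 0 < q)
    (hνA : ν A ≤ ENNReal.ofReal q) (hH : InformationTheory.klDiv μ ν ≠ ⊤) :
    (μ A).toReal ≤
      (Real.log 2 + (InformationTheory.klDiv μ ν).toReal) / Real.log (1 + q⁻¹) := by
  have hμν : μ ≪ ν := (InformationTheory.klDiv_ne_top_iff.mp hH).1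
  have hnum : 0 ≤ Real.log 2 + (InformationTheory.klDiv μ ν).toReal :=
    add_nonneg (Real.log_nonneg (by norm_num)) ENNReal.toReal_nonneg
  have hden : 0 < Real.log (1 + q⁻¹) := Real.log_pos (by have := inv_pos.mpr hq; linarith)
  set B : Set E := toMeasurable ν A with hB_def
  have hAB : A ⊆ B := subset_toMeasurable ν A
  have hBmeas : MeasurableSet B := measurableSet_toMeasurable ν A
  have hνB : ν B = ν A := measure_toMeasurable A
  have hμAB : (μ A).toReal ≤ (μ B).toReal :=
    ENNReal.toReal_mono (measure_ne_top μ B) (measure_mono hAB)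
  by_cases hB0 : ν B = 0
  · have hμB : μ B = 0 := hμν hB0
    rw [hμB, ENNReal.toReal_zero] at hμAB
    exact hμAB.trans (div_nonneg hnum hden.le)
  · have hKL := Literature.Probability.Entropy.KipnisLandim1999_A1_8_2_holds E μ ν B hBmeas hB0 hH
    have hνBq : (ν B).toReal ≤ q := by
      rw [hνB]
      exact ENNReal.toReal_le_of_le_ofReal hq.le hνA
    have hνBpos : 0 < (ν B).toReal := ENNReal.toReal_pos hB0 (measure_ne_top ν B)
    have hlog : Real.log (1 + q⁻¹) ≤ Real.log (1 + (ν B).toReal⁻¹) := by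
      apply Real.log_le_log (by have := inv_pos.mpr hq; linarith)
      have : q⁻¹ ≤ (ν B).toReal⁻¹ := by
        rw [inv_le_inv₀ hq hνBpos]; exact hνBq
      linarith
    calc (μ A).toReal ≤ (μ B).toReal := hμAB
      _ ≤ (Real.log 2 + (InformationTheory.klDiv μ ν).toReal) / Real.log (1 + (ν B).toReal⁻¹) := hKL
      _ ≤ (Real.log 2 + (InformationTheory.klDiv μ ν).toReal) / Real.log (1 + q⁻¹) :=
          div_le_div_of_nonneg_left hnum hden hlog

/-- **From vanishing specific relative entropy and exponential concentration to vanishing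
probabilities** (the passage at the end of the relative entropy method; Kipnis–Landim 1999, Ch. 6 /
App. 1 Prop. 8.2; Yau 1991; Olla–Varadhan–Yau 1993, §1): if `H(μ_N | ν_N)/(N+1) → 0` and
`ν_N(A_N) ≤ C e^{-(N+1)/C}`, then `μ_N(A_N) → 0`. [cite: KipnisLandim1999, Appendix 1 Prop. 8.2] -/
theorem tendsto_measure_of_klDiv_of_expConcentration {E : ℕ → Type} [∀ N, MeasurableSpace (E N)]
    (μ ν : ∀ N, Measure (E N)) (hμ : ∀ N, IsProbabilityMeasure (μ N))
    (hν : ∀ N, IsProbabilityMeasure (ν N)) (A : ∀ N, Set (E N))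
    (hH : Tendsto (fun N : ℕ => InformationTheory.klDiv (μ N) (ν N) / ((N : ℝ≥0∞) + 1)) atTop (𝓝 0))
    {C : ℝ} (hC : 0 < C)
    (hA : ∀ N : ℕ, ν N (A N) ≤ ENNReal.ofReal (C * Real.exp (-(C⁻¹ * (N + 1))))) :
    Tendsto (fun N : ℕ => μ N (A N)) atTop (𝓝 0) := by
  rw [ENNReal.tendsto_nhds_zero]
  intro ε hε
  -- reduce to a real target `e > 0`
  by_cases hεtop : ε = ⊤
  · exact Eventually.of_forall fun N => hεtop ▸ le_top
  set e : ℝ := ε.toReal with he_def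
  have he : 0 < e := ENNReal.toReal_pos hε.ne' hεtop
  have hεe : ENNReal.ofReal e = ε := ENNReal.ofReal_toReal hεtop
  -- entropy budget: eventually `klDiv ≤ (e/(4C)) (N+1)`
  have hbudget : ∀ᶠ N : ℕ in atTop,
      InformationTheory.klDiv (μ N) (ν N) ≤ ENNReal.ofReal (e / (4 * C)) * ((N : ℝ≥0∞) + 1) := by
    have h1 : (0 : ℝ≥0∞) < ENNReal.ofReal (e / (4 * C)) := by
      rw [ENNReal.ofReal_pos]; positivity
    filter_upwards [ENNReal.tendsto_nhds_zero.mp hH _ h1] with N hN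
    have hN1 : ((N : ℝ≥0∞) + 1) ≠ 0 := by positivity
    have hN2 : ((N : ℝ≥0∞) + 1) ≠ ⊤ := by simp
    rwa [ENNReal.div_le_iff hN1 hN2] at hN
  -- time budget: `N + 1 ≥ max (2 C log C) (8 C log 2 / e)`
  have hlarge : ∀ᶠ N : ℕ in atTop, 2 * C * Real.log C ≤ (N : ℝ) + 1 ∧ 8 * C * Real.log 2 / e ≤ (N : ℝ) + 1 := by
    obtain ⟨N₀, hN₀⟩ := exists_nat_ge (max (2 * C * Real.log C) (8 * C * Real.log 2 / e))
    filter_upwards [eventually_ge_atTop N₀] with N hN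
    have hN' : (N₀ : ℝ) ≤ (N : ℝ) + 1 := by
      have : (N₀ : ℝ) ≤ N := by exact_mod_cast hN
      linarith
    exact ⟨(le_max_left _ _).trans (hN₀.trans hN'), (le_max_right _ _).trans (hN₀.trans hN')⟩
  filter_upwards [hbudget, hlarge] with N hN hNl
  haveI := hμ N
  haveI := hν N
  have hn : (0 : ℝ) < (N : ℝ) + 1 := by positivity
  -- finiteness of the entropy and its real bound
  have hHtop : InformationTheory.klDiv (μ N) (ν N) ≠ ⊤ := by
    refine ne_top_of_le_ne_top ?_ hN
    exact ENNReal.mul_ne_top ENNReal.ofReal_ne_top (by simp)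
  have hHreal : (InformationTheory.klDiv (μ N) (ν N)).toReal ≤ e / (4 * C) * ((N : ℝ) + 1) := by
    have := ENNReal.toReal_mono (ENNReal.mul_ne_top ENNReal.ofReal_ne_top (by simp)) hN
    have hcast : ((N : ℝ≥0∞) + 1).toReal = (N : ℝ) + 1 := by
      rw [← Nat.cast_succ, ENNReal.toReal_natCast, Nat.cast_succ]
    rwa [ENNReal.toReal_mul, ENNReal.toReal_ofReal (by positivity), hcast] at this
  -- the thresholded entropy inequality with `q = C e^{-(N+1)/C}`
  set q : ℝ := C * Real.exp (-(C⁻¹ * (N + 1))) with hq_def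
  have hq : 0 < q := by positivity
  have hbound := measureReal_le_entropy_bound (μ N) (ν N) (A N) hq (hA N) hHtop
  -- `log (1 + q⁻¹) ≥ log q⁻¹ = (N+1)/C - log C ≥ (N+1)/(2C)`
  have hlogq : Real.log (1 + q⁻¹) ≥ ((N : ℝ) + 1) / (2 * C) := by
    have h1 : Real.log q⁻¹ ≤ Real.log (1 + q⁻¹) :=
      Real.log_le_log (inv_pos.mpr hq) (by linarith)
    have h2 : Real.log q⁻¹ = C⁻¹ * ((N : ℝ) + 1) - Real.log C := by
      rw [Real.log_inv, hq_def, Real.log_mul hC.ne' (Real.exp_pos _).ne', Real.log_exp]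
      ring
    have h3 : C⁻¹ * ((N : ℝ) + 1) - Real.log C ≥ ((N : ℝ) + 1) / (2 * C) := by
      rw [ge_iff_le, div_le_iff₀ (by positivity)]
      have : Real.log C * (2 * C) ≤ (N + 1) := by nlinarith [hNl.1]
      field_simp
      nlinarith [hNl.1, hC]
    linarith
  have hden : (0 : ℝ) < ((N : ℝ) + 1) / (2 * C) := by positivity
  have hnum : 0 ≤ Real.log 2 + (InformationTheory.klDiv (μ N) (ν N)).toReal :=
    add_nonneg (Real.log_nonneg (by norm_num)) ENNReal.toReal_nonneg
  have hfinal : ((μ N) (A N)).toReal ≤ e := by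
    have hH' : Real.log 2 + (InformationTheory.klDiv (μ N) (ν N)).toReal ≤
        Real.log 2 + e / (4 * C) * ((N : ℝ) + 1) := by linarith
    have step1 : ((μ N) (A N)).toReal ≤
        (Real.log 2 + e / (4 * C) * ((N : ℝ) + 1)) / (((N : ℝ) + 1) / (2 * C)) :=
      hbound.trans ((div_le_div_of_nonneg_left hnum hden hlogq).trans
        (div_le_div_of_nonneg_right hH' hden.le))
    have step2 : (Real.log 2 + e / (4 * C) * ((N : ℝ) + 1)) / (((N : ℝ) + 1) / (2 * C)) =
        2 * C * Real.log 2 / ((N : ℝ) + 1) + e / 2 := by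
      field_simp
      ring
    have step3 : 2 * C * Real.log 2 / ((N : ℝ) + 1) ≤ e / 2 := by
      rw [div_le_iff₀ hn]
      have h8 := hNl.2
      rw [div_le_iff₀ he] at h8
      nlinarith [he, hn]
    linarith [step1, step2, step3]
  rw [← hεe]
  exact (ENNReal.le_ofReal_iff_toReal_le (measure_ne_top _ _) he.le).mpr hfinal

/-- **The typed split of `AutonomousClosure`** (crux-strategist, stmt-AtomisticToContinuum-13749):
`EntropicClosure → LocalGibbsExpConcentration → AutonomousClosure`, the two hypotheses being VERBATIM the statements
filed as the route's new leaves (arrow form).  Proof: thresholds `min η₁ η₂`; smoothness domain and well-posedness by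
monotonicity in the threshold; for the convergence clause at time `t`, take the reference activity `a_t` from
`EntropicClosure`, feed its law of large numbers and the continuity/positivity of the slices `(ρ_t, u_t, θ_t)` (from the
defining `↔` of the bound predicate `IsSol`) to `LocalGibbsExpConcentration`, and conclude with
`tendsto_measure_of_klDiv_of_expConcentration` and `Measure.le_map_apply` along `Φ_t`.
[cite: KipnisLandim1999, Appendix 1 Prop. 8.2] -/
theorem autonomousClosure_of_subs :
    (∀ IsSol : (ℝ → ℝ → ℝ) → ℝ → (ℝ → Literature.MathematicalPhysics.KineticTheory.T3 → ℝ) → (ℝ → Literature.MathematicalPhysics.KineticTheory.T3 → Literature.MathematicalPhysics.KineticTheory.V3) → (ℝ → Literature.MathematicalPhysics.KineticTheory.T3 → ℝ) → Prop, (∀ p T ρ u θ, IsSol p T ρ u θ ↔ (Literature.Analysis.FunctionSpaces.Torus.IsSmoothSpaceTimeOn (Set.Ico 0 T) ρ ∧ Literature.Analysis.FunctionSpaces.Torus.IsSmoothSpaceTimeOn (Set.Ico 0 T) u ∧ Literature.Analysis.FunctionSpaces.Torus.IsSmoothSpaceTimeOn (Set.Ico 0 T) θ ∧ (∀ t ∈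 Set.Ico 0 T, ∀ x, 0 < ρ t x) ∧ (∀ t ∈ Set.Ico 0 T, ∀ x, 0 < θ t x) ∧ (∀ t ∈ Set.Ico 0 T, ∀ x, Literature.Analysis.FunctionSpaces.Torus.timeDerivWithin (Set.Ico 0 T) ρ t x + Literature.Analysis.FunctionSpaces.Torus.divergence (fun y => ρ t y • u t y) x = 0) ∧ (∀ t ∈ Set.Ico 0 T, ∀ x, Literature.Analysis.FunctionSpaces.Torus.timeDerivWithin (Set.Ico 0 T) (fun s y => ρ s y • u s y) t x + (∑ i, Literature.Analysis.FunctionSpaces.Torus.partialDeriv i (fun y => (ρ t y * u t y i) • u t y) x) + Literature.Analysis.FunctionSpaces.Torus.gradient (fun y => p (ρ t y) (θ t y)) x = 0) ∧ (∀ t ∈ Set.Ico 0 T, ∀ x, Literature.Analysis.FunctionSpaces.Torus.timeDerivWithin (Set.Ico 0 T) (fun s y => Literature.MathematicalPhysics.KineticTheory.totalEnergyDensity (ρ s y) (u s y) (θ s y)) t x + Literature.Analysis.FunctionSpaces.Torus.divergence (fun y => (Literature.MathematicalPhysics.KineticTheory.totalEnergyDensity (ρ t y) (u t y) (θ t y)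 + p (ρ t y) (θ t y)) • u t y) x = 0))) → ∃ η₀ : ℝ, 0 < η₀ ∧ ∀ σ : ℝ, 0 < σ → ∃ p : ℝ → ℝ → ℝ, ContDiffOn ℝ (⊤ : ℕ∞) (fun q : ℝ × ℝ => p q.1 q.2) {q : ℝ × ℝ | 0 < q.1 ∧ q.1 * σ ^ 3 < η₀ ∧ 0 < q.2} ∧ (∀ (ρ₀ θ₀ : Literature.MathematicalPhysics.KineticTheory.T3 → ℝ) (u₀ : Literature.MathematicalPhysics.KineticTheory.T3 → Literature.MathematicalPhysics.KineticTheory.V3), Literature.Analysis.FunctionSpaces.Torus.IsSmooth ρ₀ → Literature.Analysis.FunctionSpaces.Torus.IsSmooth θ₀ → Literature.Analysis.FunctionSpaces.Torus.IsSmooth u₀ → (∀ x, 0 < ρ₀ x) → (∀ x, 0 < θ₀ x) → (∀ x, ρ₀ x * σ ^ 3 < η₀) → ∃ T : ℝ, 0 < T ∧ ∃ (ρ θ : ℝ → Literature.MathematicalPhysics.KineticTheory.T3 → ℝ) (u : ℝ → Literature.MathematicalPhysics.KineticTheory.T3 → Literature.MathematicalPhysics.KineticTheory.V3), IsSol p T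 ρ u θ ∧ ρ 0 = ρ₀ ∧ u 0 = u₀ ∧ θ 0 = θ₀) ∧ ∀ (a₀ θ₀ : Literature.MathematicalPhysics.KineticTheory.T3 → ℝ) (u₀ : Literature.MathematicalPhysics.KineticTheory.T3 → Literature.MathematicalPhysics.KineticTheory.V3), Continuous a₀ → Continuous θ₀ → Continuous u₀ → (∀ x, 0 < a₀ x) → (∀ x, 0 < θ₀ x) → ∀ (T : ℝ) (ρ θ : ℝ → Literature.MathematicalPhysics.KineticTheory.T3 → ℝ) (u : ℝ → Literature.MathematicalPhysics.KineticTheory.T3 → Literature.MathematicalPhysics.KineticTheory.V3), IsSol p T ρ u θ → (∀ t ∈ Set.Ico 0 T, ∀ x, ρ t x * σ ^ 3 < η₀) → ∀ Φ : (N : ℕ) → Literature.Analysis.FluidPDE.HardSphereFlow (Literature.Analysis.FluidPDE.Torus.geometry (Fin 3)) (Literature.MathematicalPhysics.KineticTheory.hsDiameter σ N) (N + 1), (∀ N, MeasureTheory.IsProbabilityMeasure (Literature.MathematicalPhysics.KineticTheory.localGibbsLaw σ a₀ u₀ θ₀ N (Φ N))) → Literature.MathematicalPhysics.KineticTheory.TendstoHydroFieldsAt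 (fun N => Literature.MathematicalPhysics.KineticTheory.localGibbsLaw σ a₀ u₀ θ₀ N (Φ N)) Φ ρ u θ 0 → ∀ t ∈ Set.Ico 0 T, ∃ a : Literature.MathematicalPhysics.KineticTheory.T3 → ℝ, Continuous a ∧ (∀ x, 0 < a x) ∧ (∀ N, MeasureTheory.IsProbabilityMeasure (Literature.MathematicalPhysics.KineticTheory.localGibbsLaw σ a (u t) (θ t) N (Φ N))) ∧ Literature.MathematicalPhysics.KineticTheory.TendstoHydroFieldsAt (fun N => Literature.MathematicalPhysics.KineticTheory.localGibbsLaw σ a (u t) (θ t) N (Φ N)) Φ (fun _ => ρ t) (fun _ => u t) (fun _ => θ t) 0 ∧ Filter.Tendsto (fun N : ℕ => InformationTheory.klDiv ((Φ N).lawAt (Literature.MathematicalPhysics.KineticTheory.localGibbsLaw σ a₀ u₀ θ₀ N (Φ N)) t) (Literature.MathematicalPhysics.KineticTheory.localGibbsLaw σ a (u t) (θ t) N (Φ N)) / ((N : ENNReal) + 1)) Filter.atTop (nhds 0)) →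
    (∃ η₀ : ℝ, 0 < η₀ ∧ ∀ σ : ℝ, 0 < σ → ∀ (a θ ρV : Literature.MathematicalPhysics.KineticTheory.T3 → ℝ) (u : Literature.MathematicalPhysics.KineticTheory.T3 → Literature.MathematicalPhysics.KineticTheory.V3), Continuous a → Continuous θ → Continuous ρV → Continuous u → (∀ x, 0 < a x) → (∀ x, 0 < θ x) → (∀ x, 0 < ρV x) → (∀ x, ρV x * σ ^ 3 < η₀) → ∀ Φ : (N : ℕ) → Literature.Analysis.FluidPDE.HardSphereFlow (Literature.Analysis.FluidPDE.Torus.geometry (Fin 3)) (Literature.MathematicalPhysics.KineticTheory.hsDiameter σ N) (N + 1), (∀ N, MeasureTheory.IsProbabilityMeasure (Literature.MathematicalPhysics.KineticTheory.localGibbsLaw σ a u θ N (Φ N))) → Literature.MathematicalPhysics.KineticTheory.TendstoHydroFieldsAt (fun N => Literature.MathematicalPhysics.KineticTheory.localGibbsLaw σ a u θ N (Φ N)) Φ (fun _ => ρV) (fun _ => u) (fun _ => θ) 0 → ∀ χ : Literature.MathematicalPhysics.KineticTheory.T3 → ℝ, Continuous χ → ∀ δ : ℝ, 0 < δ → ∃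 C : ℝ, 0 < C ∧ ∀ N : ℕ, Literature.MathematicalPhysics.KineticTheory.localGibbsLaw σ a u θ N (Φ N) {z | δ < |Literature.MathematicalPhysics.KineticTheory.empiricalDensityField z χ - ∫ x, χ x * ρV x|} ≤ ENNReal.ofReal (C * Real.exp (-(C⁻¹ * (N + 1)))) ∧ Literature.MathematicalPhysics.KineticTheory.localGibbsLaw σ a u θ N (Φ N) {z | δ < ‖Literature.MathematicalPhysics.KineticTheory.empiricalMomentumField z χ - ∫ x, (χ x * ρV x) • u x‖} ≤ ENNReal.ofReal (C * Real.exp (-(C⁻¹ * (N + 1)))) ∧ Literature.MathematicalPhysics.KineticTheory.localGibbsLaw σ a u θ N (Φ N) {z | δ < |Literature.MathematicalPhysics.KineticTheory.empiricalEnergyField z χ - ∫ x, χ x * Literature.MathematicalPhysics.KineticTheory.totalEnergyDensity (ρV x) (u x) (θ x)|} ≤ ENNReal.ofReal (C * Real.exp (-(C⁻¹ * (N + 1))))) →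
    Summit.AtomisticToContinuum.HydrodynamicLimit.Theses.LoschmidtIsentropicSelection.AutonomousClosure := by
  intro h1 h2 IsSol hIsSol
  obtain ⟨η₁, hη₁, H1⟩ := h1 IsSol hIsSol
  obtain ⟨η₂, hη₂, H2⟩ := h2
  refine ⟨min η₁ η₂, lt_min hη₁ hη₂, fun σ hσ => ?_⟩
  obtain ⟨p, hp, hWP, hCONV⟩ := H1 σ hσ
  refine ⟨p, hp.mono ?_, ?_, ?_⟩
  · rintro q ⟨hq1, hq2, hq3⟩
    exact ⟨hq1, lt_of_lt_of_le hq2 (min_le_left _ _), hq3⟩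
  · intro ρ₀ θ₀ u₀ hρ hθ hu hρ0 hθ0 hpack
    exact hWP ρ₀ θ₀ u₀ hρ hθ hu hρ0 hθ0 fun x => lt_of_lt_of_le (hpack x) (min_le_left _ _)
  · intro a₀ θ₀ u₀ ha hθ hu ha0 hθ0 T ρ θ u hsol hguard Φ hprob h0 t ht
    have hguard₁ : ∀ s ∈ Set.Ico 0 T, ∀ x, ρ s x * σ ^ 3 < η₁ :=
      fun s hs x => lt_of_lt_of_le (hguard s hs x) (min_le_left _ _)
    obtain ⟨a, ha_cont, ha_pos, hprob_a, hreal, hent⟩ :=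
      hCONV a₀ θ₀ u₀ ha hθ hu ha0 hθ0 T ρ θ u hsol hguard₁ Φ hprob h0 t ht
    have hcl := (hIsSol p T ρ u θ).mp hsol
    have hρc : Continuous (ρ t) := (hcl.1.isSmooth_slice ht).continuous
    have huc : Continuous (u t) := (hcl.2.1.isSmooth_slice ht).continuous
    have hθc : Continuous (θ t) := (hcl.2.2.1.isSmooth_slice ht).continuous
    have hρpos : ∀ x, 0 < ρ t x := hcl.2.2.2.1 t ht
    have hθpos : ∀ x, 0 < θ t x := hcl.2.2.2.2.1 t ht
    have hguard₂ : ∀ x, ρ t x * σ ^ 3 < η₂ :=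
      fun x => lt_of_lt_of_le (hguard t ht x) (min_le_right _ _)
    have hconc := H2 σ hσ a (θ t) (ρ t) (u t) ha_cont hθc hρc huc ha_pos hθpos hρpos hguard₂ Φ
      hprob_a hreal
    intro χ hχ δ hδ
    obtain ⟨C, hC, hCN⟩ := hconc χ hχ δ hδ
    have hμ : ∀ N, IsProbabilityMeasure ((Φ N).lawAt
        (Literature.MathematicalPhysics.KineticTheory.localGibbsLaw σ a₀ u₀ θ₀ N (Φ N)) t) := fun N => by
      rw [Literature.Analysis.FluidPDE.HardSphereFlow.lawAt_eq]
      exact Measure.isProbabilityMeasure_map ((Φ N).measurable_flow t).aemeasurable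
    have key : ∀ P : (N : ℕ) → Literature.Analysis.FluidPDE.Config (N + 1) (Fin 3)
        Literature.MathematicalPhysics.KineticTheory.T3 → Prop,
        (∀ N, Literature.MathematicalPhysics.KineticTheory.localGibbsLaw σ a (u t) (θ t) N (Φ N) {z | P N z} ≤
          ENNReal.ofReal (C * Real.exp (-(C⁻¹ * (N + 1))))) →
        Tendsto (fun N => Literature.MathematicalPhysics.KineticTheory.localGibbsLaw σ a₀ u₀ θ₀ N (Φ N)
          {z | P N ((Φ N).flow t z)}) atTop (𝓝 0) := by
      intro P hPN
      have hlim := tendsto_measure_of_klDiv_of_expConcentration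
        (fun N => (Φ N).lawAt (Literature.MathematicalPhysics.KineticTheory.localGibbsLaw σ a₀ u₀ θ₀ N (Φ N)) t)
        (fun N => Literature.MathematicalPhysics.KineticTheory.localGibbsLaw σ a (u t) (θ t) N (Φ N)) hμ hprob_a
        (fun N => {z | P N z}) hent hC hPN
      refine tendsto_of_tendsto_of_tendsto_of_le_of_le tendsto_const_nhds hlim (fun N => bot_le)
        fun N => ?_
      show Literature.MathematicalPhysics.KineticTheory.localGibbsLaw σ a₀ u₀ θ₀ N (Φ N)
          ((Φ N).flow t ⁻¹' {z | P N z}) ≤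
        ((Φ N).lawAt (Literature.MathematicalPhysics.KineticTheory.localGibbsLaw σ a₀ u₀ θ₀ N (Φ N)) t)
          {z | P N z}
      rw [Literature.Analysis.FluidPDE.HardSphereFlow.lawAt_eq]
      exact Measure.le_map_apply ((Φ N).measurable_flow t).aemeasurable _
    exact ⟨key (fun N z => δ < |Literature.MathematicalPhysics.KineticTheory.empiricalDensityField z χ -
          ∫ x, χ x * ρ t x|) fun N => (hCN N).1,
      key (fun N z => δ < ‖Literature.MathematicalPhysics.KineticTheory.empiricalMomentumField z χ -
          ∫ x, (χ x * ρ t x) • u t x‖) fun N => (hCN N).2.1,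
      key (fun N z => δ < |Literature.MathematicalPhysics.KineticTheory.empiricalEnergyField z χ -
          ∫ x, χ x * Literature.MathematicalPhysics.KineticTheory.totalEnergyDensity (ρ t x) (u t x) (θ t x)|)
        fun N => (hCN N).2.2⟩

end Summit.AtomisticToContinuum.HydrodynamicLimit.Theorems
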